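import Mathlib
import Literature.Barriers.NavierStokesRegularity.DyadicInvariantRegion
import HarnessLib

/-!
# Face inequalities of the Barbato–Morandin–Romito region WITH DAMPING SLACK — scale ratios `b ∈ [1.9, 2]`
(helper file for crux stmt-NavierStokesRegularity-27057 `SubOnsagerCeiling.ForwardTailCeilingKP`,
`--supports … --as helper`; LEAD SOC census v6 §C «joint region chain + slaved side drain»)

The chain certificates in the tree (`SubOnsagerCeilingDyadicRangeRegionIneq`, g3: `p ≥ 42/25`, `L ≥ p²`,
`pc = 1`; the two-window region `{h(x) ≤ y ≤ min(x/2 + 3/5, 1)}`, `h(x) = c((x - 1/10)/(9/10))⁴`) are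
proved for the EXACT rescaled Katz–Pavlović law `Ẏₙ = -κₙYₙ + Fₙ(Y²ₙ₋₁ - pYₙYₙ₊₁)`. A KP network proper
drains the chain through its in-shell pumps into side sources (`-PΛₙ sₙ·xₙ`, `sₙ` slaved by the pair lemma
`kpProper_pairSlaving`, p646904): in rescaled variables this is an EXTRA, time-dependent, non-negative
damping `-Dₙ(t)Yₙ` with `Dₙ(t) ≤ D̄·Fₙ`, about which nothing else (no monotonicity in `n`) is known. The
upper faces are helped by it; the two faces whose inward inequality uses the LOWER shell's or the UPPER
shell's damping with the wrong sign — the slanted top (`+D̄Fₙx/2`) and the curved bottom (`+D̄Fₙ₊₁y`) —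
need inviscid slack. This file re-certifies them at the threshold `p ≥ 47/25` (Tao's lattice: every
`b ∈ [1.9, 2]` at `θ = 101/200`) with slack `D̄ ≤ 1/5`:

* `top_poly_nonneg_damped`, `top_ineq_damped` — `(1/2)xy + (5/94)x ≤ (47/25)(y((y-δ)/(1-δ))⁴ - x²)` on the
  slanted piece (Bernstein coefficients of the quintic on `[0, 4/5]` all `≥ 0.017`);
* `bottom_poly_pos_damped`, `bottom_bound_damped`, `bottom_ineq_damped` — the bottom inequality with the
  extra term `-D·L·c·u⁴`, margin `3/100` (Bernstein coefficients of the octic on `[0,1]` all `≥ 0.035`);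
* `top_slant_deriv_neg_damped`, `bottom_curve_deriv_neg_damped`, `bottom_corner_deriv_neg_damped`,
  `rhs_le_at_one_damped` — the face-derivative inequalities in TWO-SIDED form: the derivatives `Ẏₙ` are
  abstract numbers squeezed between `Gₙ - D̄FₙYₙ` and `Gₙ = -κₙYₙ + Fₙ(Y²ₙ₋₁ - pYₙYₙ₊₁)`.

HONEST FRAMING: polynomial inequalities towards a MODEL-lattice rung (crux `ForwardTailCeilingKP`, route
SubOnsagerCeiling, TL-M2Break); nothing here bears on Navier–Stokes regularity.
[cite: BarbatoMorandinRomito2011, §2 Lemma 2.1 (2.2)–(2.3) (the unperturbed faces)]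
-/

noncomputable section

-- the sub-problem namespace `NavierStokesRegularity.NavierStokesRegularity` is the tree's layout (D-0017)
set_option linter.dupNamespace false

namespace Summit.NavierStokesRegularity.NavierStokesRegularity.Theorems.DyadicDamped

open Real

/-! ## The slanted piece with slack -/

/-- The quintic `T(x) = (47/25)(y u⁴ - x²) - (1/2)xy - (5/94)x`, `y = x/2 + 3/5`, `u = 5(x+1)/9`, expanded,
is non-negative on `[0, 4/5]`: Bernstein coefficients `≥ 0.017`. [this file] -/
theorem top_poly_nonneg_damped {x : ℝ} (hx0 : 0 ≤ x) (hx1 : x ≤ 4 / 5) :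
    0 ≤ (235 / 2187 : ℝ) + 512399 / 3083670 * x - 739493 / 656100 * x ^ 2 + 235 / 243 * x ^ 3 +
      3055 / 6561 * x ^ 4 + 1175 / 13122 * x ^ 5 := by
  have h1 : 0 ≤ 4 / 5 - x := by linarith
  nlinarith [pow_nonneg h1 5, mul_nonneg hx0 (pow_nonneg h1 4),
    mul_nonneg (pow_nonneg hx0 2) (pow_nonneg h1 3), mul_nonneg (pow_nonneg hx0 3) (pow_nonneg h1 2),
    mul_nonneg (pow_nonneg hx0 4) h1, pow_nonneg hx0 5]

/-- **The slanted piece with slack** (`δ = 1/10`, `m = 1/2`, threshold `p = 47/25`, slack `D̄ = 1/5`, i.e.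
`D̄x/(2p) = (5/94)x`): `(1/2)xy + (5/94)x ≤ (47/25)(y((y-δ)/(1-δ))⁴ - x²)` for `x ≥ 0`, `y = x/2+3/5 ≤ 1`.
[this file] -/
theorem top_ineq_damped {x y : ℝ} (hx : 0 ≤ x) (hy : y = 1 / 2 * x + 3 / 5) (hy1 : y ≤ 1) :
    1 / 2 * x * y + 5 / 94 * x ≤ 47 / 25 * (y * ((y - 1 / 10) / (9 / 10)) ^ 4 - x ^ 2) := by
  subst hy
  have hx1 : x ≤ 4 / 5 := by linarith
  have key := top_poly_nonneg_damped hx hx1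
  have h18 : (1 / 2 * x + 3 / 5 - 1 / 10) / (9 / 10) = (5 * x + 5) / 9 := by ring
  rw [h18]
  nlinarith [key]

/-! ## The curved bottom piece with slack -/

/-- The damped bottom octic on `[0, 1]`: Bernstein coefficients `≥ 0.035`. [this file] -/
theorem bottom_poly_pos_damped {u : ℝ} (hu0 : 0 ≤ u) (hu1 : u ≤ 1) :
    (3 / 100 : ℝ) ≤ 2209 / 62500 + 19881 / 31250 * u + 178929 / 62500 * u ^ 2 - 1000 / 423 * u ^ 3 -
      7802 / 3125 * u ^ 4 + 100 / 423 * u ^ 7 + 2791 / 2350 * u ^ 8 := by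
  have h1 : 0 ≤ 1 - u := by linarith
  nlinarith [pow_nonneg h1 8, mul_nonneg hu0 (pow_nonneg h1 7),
    mul_nonneg (pow_nonneg hu0 2) (pow_nonneg h1 6), mul_nonneg (pow_nonneg hu0 3) (pow_nonneg h1 5),
    mul_nonneg (pow_nonneg hu0 4) (pow_nonneg h1 4), mul_nonneg (pow_nonneg hu0 5) (pow_nonneg h1 3),
    mul_nonneg (pow_nonneg hu0 6) (pow_nonneg h1 2), mul_nonneg (pow_nonneg hu0 7) h1,
    pow_nonneg hu0 8]

/-- The damped bottom polynomial in BMR's variables at the threshold `p = 47/25`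
(`p² = 2209/625`, `1/(2p) = 25/94`, `D̄/p = 5/47`, `4/((1-δ)p) = 1000/423`): for `u ∈ [0,1]`,
`x = 1/10 + (9/10)u`, `(2209/625)(x² - u⁴((25/94)u⁴ + 3/5) - (5/47)u⁴) - (1000/423)u³(1 - xu⁴) ≥ 3/100`.
[this file] -/
theorem bottom_bound_damped {u x : ℝ} (hu0 : 0 ≤ u) (hu1 : u ≤ 1) (hx : x = 1 / 10 + 9 / 10 * u) :
    (3 / 100 : ℝ) ≤ 2209 / 625 * (x ^ 2 - u ^ 4 * (25 / 94 * u ^ 4 + 3 / 5) - 5 / 47 * u ^ 4) -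
      1000 / 423 * u ^ 3 * (1 - x * u ^ 4) := by
  have h := bottom_poly_pos_damped hu0 hu1
  subst hx
  have : 2209 / 625 * ((1 / 10 + 9 / 10 * u) ^ 2 - u ^ 4 * (25 / 94 * u ^ 4 + 3 / 5) - 5 / 47 * u ^ 4) -
      1000 / 423 * u ^ 3 * (1 - (1 / 10 + 9 / 10 * u) * u ^ 4) =
      2209 / 62500 + 19881 / 31250 * u + 178929 / 62500 * u ^ 2 - 1000 / 423 * u ^ 3 -
      7802 / 3125 * u ^ 4 + 100 / 423 * u ^ 7 + 2791 / 2350 * u ^ 8 := by ring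
  linarith

/-- **The damped bottom-piece inequality in the form used by the dynamical argument.** For
`x ∈ [1/10, 1]`, `u = (x-δ)/(1-δ)`, coefficients `p ≥ 47/25`, `L ≥ p²`, `pc = 1` and slack `D ≤ 1/5`:
`L(x² - u⁴(cu⁴/2 + 3/5)) - (4c/(1-δ))u³(1 - xu⁴) - D·L·(c u⁴) > 0`. [this file] -/
theorem bottom_ineq_damped {x L p c D : ℝ} (hx0 : 1 / 10 ≤ x) (hx1 : x ≤ 1) (hp : 47 / 25 ≤ p)
    (hL : p ^ 2 ≤ L) (hpc : p * c = 1) (hD : D ≤ 1 / 5) :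
    0 < L * (x ^ 2 - ((x - 1 / 10) / (9 / 10)) ^ 4 * (1 / 2 * c * ((x - 1 / 10) / (9 / 10)) ^ 4 + 3 / 5)) -
      4 * c / (9 / 10) * ((x - 1 / 10) / (9 / 10)) ^ 3 * (1 - x * ((x - 1 / 10) / (9 / 10)) ^ 4) -
      D * L * (c * ((x - 1 / 10) / (9 / 10)) ^ 4) := by
  set u : ℝ := (x - 1 / 10) / (9 / 10) with hu
  have hxu : x = 1 / 10 + 9 / 10 * u := by rw [hu]; ring
  have hu0 : 0 ≤ u := by rw [hu]; apply div_nonneg <;> linarith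
  have hu1 : u ≤ 1 := by rw [hu, div_le_one (by norm_num)]; linarith
  have hux : u ≤ x := by linarith
  have hp0 : 0 < p := by linarith
  have hc0 : 0 < c := by
    have : 0 < p * c := by rw [hpc]; exact one_pos
    exact pos_of_mul_pos_right this hp0.le
  -- `c = 1/p ≤ 25/47`
  have hc1 : c ≤ 25 / 47 := by
    have : 47 / 25 * c ≤ p * c := mul_le_mul_of_nonneg_right hp hc0.le
    rw [hpc] at this
    linarith
  have hu4 : u ^ 4 ≤ u ^ 2 := by nlinarith [pow_nonneg hu0 2, mul_le_one₀ hu1 hu0 hu1]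
  have hu2x : u ^ 2 ≤ x ^ 2 := pow_le_pow_left₀ hu0 hux 2
  have hu8 : u ^ 8 ≤ u ^ 4 := by
    have h44 : u ^ 8 = u ^ 4 * u ^ 4 := by ring
    rw [h44]; exact mul_le_of_le_one_right (pow_nonneg hu0 4) (pow_le_one₀ hu0 hu1)
  -- the bracket (with the slack) is non-negative, uniformly in `c ≤ 25/47`, `D ≤ 1/5`
  have hbr : 0 ≤ x ^ 2 - u ^ 4 * (1 / 2 * c * u ^ 4 + 3 / 5) - D * (c * u ^ 4) := by
    have e : x ^ 2 - u ^ 4 * (1 / 2 * c * u ^ 4 + 3 / 5) - D * (c * u ^ 4) =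
        x ^ 2 - 3 / 5 * u ^ 4 - 1 / 2 * c * u ^ 8 - D * c * u ^ 4 := by ring
    rw [e]
    have h1 : 1 / 2 * c * u ^ 8 ≤ 25 / 94 * u ^ 4 := by nlinarith [pow_nonneg hu0 8, pow_nonneg hu0 4]
    have h2 : D * c * u ^ 4 ≤ 5 / 47 * u ^ 4 := by
      have : D * c ≤ 1 / 5 * (25 / 47) := mul_le_mul hD hc1 hc0.le (by norm_num)
      nlinarith [pow_nonneg hu0 4]
    nlinarith [pow_nonneg hu0 4]
  have hB : 0 ≤ 1 - x * u ^ 4 := by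
    have : u ^ 4 ≤ 1 := pow_le_one₀ hu0 hu1
    nlinarith [pow_nonneg hu0 4]
  have hu3 : 0 ≤ u ^ 3 := pow_nonneg hu0 3
  have key := bottom_bound_damped hu0 hu1 hxu
  -- monotone replacement: `L ≥ p² ≥ (47/25)²`, `c ≤ 25/47`, `D ≤ 1/5`
  have hL' : (2209 / 625 : ℝ) ≤ L := by nlinarith
  have e1 : 2209 / 625 * (x ^ 2 - u ^ 4 * (25 / 94 * u ^ 4 + 3 / 5) - 5 / 47 * u ^ 4) ≤
      L * (x ^ 2 - u ^ 4 * (1 / 2 * c * u ^ 4 + 3 / 5) - D * (c * u ^ 4)) := by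
    have h1 : x ^ 2 - u ^ 4 * (25 / 94 * u ^ 4 + 3 / 5) - 5 / 47 * u ^ 4 ≤
        x ^ 2 - u ^ 4 * (1 / 2 * c * u ^ 4 + 3 / 5) - D * (c * u ^ 4) := by
      have : D * c ≤ 1 / 5 * (25 / 47) := mul_le_mul hD hc1 hc0.le (by norm_num)
      nlinarith [pow_nonneg hu0 8, pow_nonneg hu0 4]
    calc 2209 / 625 * (x ^ 2 - u ^ 4 * (25 / 94 * u ^ 4 + 3 / 5) - 5 / 47 * u ^ 4)
        ≤ 2209 / 625 * (x ^ 2 - u ^ 4 * (1 / 2 * c * u ^ 4 + 3 / 5) - D * (c * u ^ 4)) :=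
          mul_le_mul_of_nonneg_left h1 (by norm_num)
      _ ≤ L * (x ^ 2 - u ^ 4 * (1 / 2 * c * u ^ 4 + 3 / 5) - D * (c * u ^ 4)) :=
          mul_le_mul_of_nonneg_right hL' hbr
  have e2 : 4 * c / (9 / 10) * u ^ 3 * (1 - x * u ^ 4) ≤ 1000 / 423 * u ^ 3 * (1 - x * u ^ 4) := by
    have : 4 * c / (9 / 10) ≤ 1000 / 423 := by
      rw [div_le_iff₀ (by norm_num)]; linarith
    exact mul_le_mul_of_nonneg_right (mul_le_mul_of_nonneg_right this hu3) hB
  have e3 : L * (x ^ 2 - u ^ 4 * (1 / 2 * c * u ^ 4 + 3 / 5)) -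
      4 * c / (9 / 10) * u ^ 3 * (1 - x * u ^ 4) - D * L * (c * u ^ 4) =
      L * (x ^ 2 - u ^ 4 * (1 / 2 * c * u ^ 4 + 3 / 5) - D * (c * u ^ 4)) -
      4 * c / (9 / 10) * u ^ 3 * (1 - x * u ^ 4) := by ring
  rw [e3]
  linarith

/-! ## Inward pointing on the boundary pieces, two-sided dynamics -/

/-- **Top face `Yₙ = 1`** (upper bound on `Ẏₙ` only): `Ẏₙ ≤ -κₙ + Fₙ(w² - p z) < 0` when `w ≤ 1`,
`z ≥ c = h(1)`, `pc = 1`. [cite: BarbatoMorandinRomito2011, §2 Lemma 2.1 (proof, piece n₁)] -/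
theorem rhs_le_at_one_damped {κ F p c w z Y' : ℝ} (hκ : 0 < κ) (hF : 0 ≤ F) (hp : 0 ≤ p) (hpc : p * c = 1)
    (hw0 : 0 ≤ w) (hw1 : w ≤ 1) (hz : c ≤ z) (hup : Y' ≤ -κ * 1 + F * (w ^ 2 - p * 1 * z)) : Y' < 0 :=
  lt_of_le_of_lt hup (Literature.Barriers.NavierStokesRegularity.Dyadic.rhs_neg_at_one hκ hF hp hpc hw0 hw1 hz)

/-- **Slanted top piece `y = x/2 + 3/5` with slack**: if `Ẏₙ₊₁ ≤ Gₙ₊₁` and `Ẏₙ ≥ Gₙ - D̄Fₙx` with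
`D̄ ≤ 1/5`, then `Ẏₙ₊₁ - Ẏₙ/2 < 0` on the piece (`p ≥ 47/25`, `L ≥ p²`, `pc = 1`, `z ≥ h(y)`).
[this file] -/
theorem top_slant_deriv_neg_damped {κn κn1 Fn L p c x y z w Db Yn' Yn1' : ℝ} (hκn : 0 < κn)
    (hκmono : κn ≤ κn1) (hFn : 0 < Fn) (hp : 47 / 25 ≤ p) (hpL : p ^ 2 ≤ L) (hpc : p * c = 1)
    (hx : 0 ≤ x) (hy : y = 1 / 2 * x + 3 / 5) (hy1 : y ≤ 1)
    (hz : c * ((y - 1 / 10) / (9 / 10)) ^ 4 ≤ z) (hDb : Db ≤ 1 / 5)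
    (hup : Yn1' ≤ -κn1 * y + L * Fn * (x ^ 2 - p * y * z))
    (hlo : -κn * x + Fn * (w ^ 2 - p * x * y) - Db * Fn * x ≤ Yn') :
    Yn1' - 1 / 2 * Yn' < 0 := by
  have hy0 : 0 < y := by rw [hy]; positivity
  have hp0 : 0 < p := by linarith
  have hL : 0 < L := lt_of_lt_of_le (by positivity) hpL
  -- viscous part
  have hv : -κn1 * y + 1 / 2 * (κn * x) < 0 := by
    have : κn * y ≤ κn1 * y := mul_le_mul_of_nonneg_right hκmono hy0.le
    rw [hy] at this ⊢
    nlinarith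
  -- inviscid part with slack: `L (x² - p y z) + (1/2) p x y + Db x / 2 ≤ 0`
  have hψ := top_ineq_damped hx hy hy1
  set q : ℝ := y * ((y - 1 / 10) / (9 / 10)) ^ 4 with hq
  have hu4 : q ≤ p * y * z := by
    have := mul_le_mul_of_nonneg_left hz (mul_nonneg hp0.le hy0.le)
    calc q = p * y * (c * ((y - 1 / 10) / (9 / 10)) ^ 4) := by
          rw [show p * y * (c * ((y - 1 / 10) / (9 / 10)) ^ 4) =
            (p * c) * (y * ((y - 1 / 10) / (9 / 10)) ^ 4) by ring, hpc, one_mul]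
      _ ≤ p * y * z := this
  have hneg : x ^ 2 - q ≤ 0 := by nlinarith [mul_nonneg hx hy0.le]
  have hi : L * (x ^ 2 - p * y * z) + 1 / 2 * (p * x * y) + Db * x / 2 ≤ 0 := by
    have h1 : L * (x ^ 2 - p * y * z) ≤ L * (x ^ 2 - q) := by
      apply mul_le_mul_of_nonneg_left _ hL.le; linarith
    have h2 : L * (x ^ 2 - q) ≤ p ^ 2 * (x ^ 2 - q) := by nlinarith
    have h4 : p * (x ^ 2 - q) ≤ 47 / 25 * (x ^ 2 - q) := by nlinarith
    have h5 : 47 / 25 * (x ^ 2 - q) + 1 / 2 * x * y + 5 / 94 * x ≤ 0 := by rw [hq]; linarith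
    -- `Db x/2 ≤ p · (5/94) x` since `Db ≤ 1/5` and `p ≥ 47/25`
    have h7 : Db * x / 2 ≤ p * (5 / 94 * x) := by
      have : Db * x ≤ 1 / 5 * x := mul_le_mul_of_nonneg_right hDb hx
      nlinarith
    have h3 : p ^ 2 * (x ^ 2 - q) + 1 / 2 * (p * x * y) + p * (5 / 94 * x) =
        p * (p * (x ^ 2 - q) + 1 / 2 * x * y + 5 / 94 * x) := by ring
    have h6 : p * (p * (x ^ 2 - q) + 1 / 2 * x * y + 5 / 94 * x) ≤ 0 :=
      mul_nonpos_of_nonneg_of_nonpos hp0.le (by linarith)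
    linarith
  have hw : 0 ≤ Fn * w ^ 2 := mul_nonneg hFn.le (sq_nonneg w)
  have key : Yn1' - 1 / 2 * Yn' ≤
      (-κn1 * y + 1 / 2 * (κn * x)) + Fn * (L * (x ^ 2 - p * y * z) + 1 / 2 * (p * x * y) + Db * x / 2) -
        1 / 2 * (Fn * w ^ 2) := by nlinarith
  nlinarith [mul_nonpos_of_nonneg_of_nonpos hFn.le hi]

/-- **Curved bottom piece `y = h(x)`, `x > δ`, with slack**: if `Ẏₙ ≤ Gₙ` and
`Ẏₙ₊₁ ≥ Gₙ₊₁ - D̄(LFₙ)y` with `D̄ ≤ 1/5`, then `h'(x)Ẏₙ - Ẏₙ₊₁ < 0` on the piece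
(`p ≥ 47/25`, `L ≥ p²`, `pc = 1`, `κₙ₊₁ ≤ 4κₙ`, `z ≤ y/2 + 3/5`, `w ∈ [0,1]`). [this file] -/
theorem bottom_curve_deriv_neg_damped {κn κn1 Fn L p c x y z w Db Yn' Yn1' : ℝ} (hκn : 0 ≤ κn)
    (hκ4 : κn1 ≤ 4 * κn) (hFn : 0 < Fn) (hp : 47 / 25 ≤ p) (hpL : p ^ 2 ≤ L) (hpc : p * c = 1)
    (hx0 : 1 / 10 ≤ x) (hx1 : x ≤ 1) (hy : y = c * ((x - 1 / 10) / (9 / 10)) ^ 4)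
    (hz : z ≤ 1 / 2 * y + 3 / 5) (hw0 : 0 ≤ w) (hw1 : w ≤ 1) (hDb : Db ≤ 1 / 5)
    (hup : Yn' ≤ -κn * x + Fn * (w ^ 2 - p * x * y))
    (hlo : -κn1 * y + L * Fn * (x ^ 2 - p * y * z) - Db * (L * Fn) * y ≤ Yn1') :
    4 * c * ((x - 1 / 10) / (9 / 10)) ^ 3 / (9 / 10) * Yn' - Yn1' < 0 := by
  have hp0 : 0 < p := by linarith
  have hc0 : 0 < c := by
    have : 0 < p * c := by rw [hpc]; exact one_pos
    exact pos_of_mul_pos_right this hp0.le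
  have hL0 : 0 ≤ L := le_trans (sq_nonneg p) hpL
  set u : ℝ := (x - 1 / 10) / (9 / 10) with hu
  obtain ⟨hu0, hu1⟩ := Literature.Barriers.NavierStokesRegularity.Dyadic.sub_delta_div_mem hx0 hx1
  have hy0 : 0 ≤ y := by rw [hy]; positivity
  have hu3 : 0 ≤ u ^ 3 := pow_nonneg hu0 3
  have hh' : 0 ≤ 4 * c * u ^ 3 / (9 / 10) := by positivity
  -- replace the derivatives by their bounds
  have hstep : 4 * c * u ^ 3 / (9 / 10) * Yn' - Yn1' ≤
      4 * c * u ^ 3 / (9 / 10) * (-κn * x + Fn * (w ^ 2 - p * x * y)) -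
        (-κn1 * y + L * Fn * (x ^ 2 - p * y * z) - Db * (L * Fn) * y) := by
    have := mul_le_mul_of_nonneg_left hup hh'
    linarith
  -- viscous part: `h'(x) κₙ x ≥ 4 κₙ h(x) ≥ κ_{n+1} h(x)`
  have hv : 0 ≤ 4 * c * u ^ 3 / (9 / 10) * (κn * x) - κn1 * y := by
    have hxu : x / (9 / 10) = u + (1 / 10) / (9 / 10) := by rw [hu]; ring
    have h2 : κn1 * y ≤ 4 * κn * y := mul_le_mul_of_nonneg_right hκ4 hy0
    have h3 : 4 * κn * y ≤ 4 * κn * (c * u ^ 3) * (x / (9 / 10)) := by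
      rw [hy, hxu]
      have : c * u ^ 4 ≤ c * u ^ 3 * (u + 1 / 10 / (9 / 10)) := by
        have : (0 : ℝ) ≤ c * u ^ 3 * (1 / 10 / (9 / 10)) := by positivity
        nlinarith
      have := mul_le_mul_of_nonneg_left this (by positivity : (0 : ℝ) ≤ 4 * κn)
      linarith [this]
    have h1 : 4 * c * u ^ 3 / (9 / 10) * (κn * x) = 4 * κn * (c * u ^ 3) * (x / (9 / 10)) := by ring
    linarith
  -- inviscid part with slack
  have hyu : p * y = u ^ 4 := by
    rw [hy, show p * (c * u ^ 4) = (p * c) * u ^ 4 by ring, hpc, one_mul]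
  have hxy : p * x * y = x * u ^ 4 := by rw [mul_comm p x, mul_assoc, hyu]
  have hB : 0 ≤ 1 - x * u ^ 4 := by
    have : u ^ 4 ≤ 1 := pow_le_one₀ hu0 hu1
    nlinarith [pow_nonneg hu0 4]
  have hnum := bottom_ineq_damped (L := L) hx0 hx1 hp hpL hpc hDb
  have h1 : x ^ 2 - u ^ 4 * (1 / 2 * c * u ^ 4 + 3 / 5) ≤ x ^ 2 - p * y * z := by
    have : p * y * z ≤ u ^ 4 * (1 / 2 * y + 3 / 5) := by
      rw [hyu]; exact mul_le_mul_of_nonneg_left hz (pow_nonneg hu0 4)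
    have hyc : u ^ 4 * (1 / 2 * y + 3 / 5) = u ^ 4 * (1 / 2 * c * u ^ 4 + 3 / 5) := by rw [hy]; ring
    linarith
  have h2 : w ^ 2 - p * x * y ≤ 1 - x * u ^ 4 := by rw [hxy]; nlinarith
  have key : 4 * c * u ^ 3 / (9 / 10) * (-κn * x + Fn * (w ^ 2 - p * x * y)) -
      (-κn1 * y + L * Fn * (x ^ 2 - p * y * z) - Db * (L * Fn) * y) =
      -(4 * c * u ^ 3 / (9 / 10) * (κn * x) - κn1 * y) -
        Fn * (L * (x ^ 2 - p * y * z) - 4 * c / (9 / 10) * u ^ 3 * (w ^ 2 - p * x * y) -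
          Db * L * y) := by ring
  have h3 : L * (x ^ 2 - u ^ 4 * (1 / 2 * c * u ^ 4 + 3 / 5)) - 4 * c / (9 / 10) * u ^ 3 * (1 - x * u ^ 4) -
      Db * L * (c * u ^ 4) ≤
      L * (x ^ 2 - p * y * z) - 4 * c / (9 / 10) * u ^ 3 * (w ^ 2 - p * x * y) - Db * L * y := by
    have e1 := mul_le_mul_of_nonneg_left h1 hL0
    have e2 := mul_le_mul_of_nonneg_left h2 (by positivity : (0 : ℝ) ≤ 4 * c / (9 / 10) * u ^ 3)
    have e3 : Db * L * y = Db * L * (c * u ^ 4) := by rw [hy]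
    linarith
  have h4 : 0 < L * (x ^ 2 - p * y * z) - 4 * c / (9 / 10) * u ^ 3 * (w ^ 2 - p * x * y) - Db * L * y :=
    hnum.trans_le h3
  have := mul_pos hFn h4
  linarith [hstep, key ▸ hstep]

/-- **Bottom corner `x = δ`** (`h = h' = 0`, `y = 0`): `0·Ẏₙ - Ẏₙ₊₁ < 0` since
`Ẏₙ₊₁ ≥ -κₙ₊₁·0 + LFₙ(δ² - 0) - D̄LFₙ·0 > 0`. [this file] -/
theorem bottom_corner_deriv_neg_damped {κn1 Fn L p A Db Yn' Yn1' : ℝ} (hF : 0 < Fn) (hL : 0 < L)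
    (hlo : -κn1 * 0 + L * Fn * ((1 / 10 : ℝ) ^ 2 - p * 0 * A) - Db * (L * Fn) * 0 ≤ Yn1') :
    (0 : ℝ) * Yn' - Yn1' < 0 := by
  have : 0 < L * Fn * ((1 / 10 : ℝ) ^ 2 - p * 0 * A) := by
    have : (1 / 10 : ℝ) ^ 2 - p * 0 * A = 1 / 100 := by ring
    rw [this]; positivity
  nlinarith

end Summit.NavierStokesRegularity.NavierStokesRegularity.Theorems.DyadicDamped

end
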